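import Summits.HodgeConjecture.HodgeConjecture.Theorems.NikulinTwinTransportTwinAnchorGlue
import Summits.HodgeConjecture.HodgeConjecture.Theorems.EndoscopicMiddleDegreeCupProductAlgebraic

/-!
# Route `NikulinTwinTransport` — support item `TwinAnchorGlue` (stmt-HodgeConjecture-14394), PROVED

`TwinAnchorGlue : HodgeIsometryAlgebraic → TwinTwistorTransport → TwinSimilitudeAlgebraic` (Varesco 2023 §2,
"similarity = algebraic similarity ∘ isometry", with the twin in place of the Nikulin quotient).  The tree's
`twinAnchorGlue_of_cup` (file `NikulinTwinTransportTwinAnchorGlue`) reduces the item to the multiplicativity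
`N² H⁴ ∪ N² H⁴ ⊆ N⁴ H⁸` of algebraically supported classes on the triple products `A ⊗ (B ⊗ C)` of smooth
projective surfaces — and that multiplicativity is now a THEOREM of the tree on every smooth projective
complex variety: `Voisin2003_cupProduct_algebraicClasses_holds` (file `EndoscopicMiddleDegreeCupProductAlgebraic`,
diagonal pull-back of the exterior product, Voisin II Prop. 9.20 / Fulton §19.2).  This file feeds the one
into the other.  No definition, no named-fact hypothesis, no sorry.
-/

noncomputable section

-- every declaration of this problem lives in `Summit.HodgeConjecture.HodgeConjecture.…` (summit = sub-problem)
set_option linter.dupNamespace false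

namespace Summit.HodgeConjecture.HodgeConjecture.Theorems

open CategoryTheory MonoidalCategory
open Literature.AlgebraicGeometry.Motives Literature.AlgebraicGeometry.HodgeTheory

/-- **Item stmt-HodgeConjecture-14394 (`TwinAnchorGlue`, route `NikulinTwinTransport`)**:
`HodgeIsometryAlgebraic → TwinTwistorTransport → TwinSimilitudeAlgebraic` — `twinAnchorGlue_of_cup` with its
multiplicativity hypothesis discharged by `Voisin2003_cupProduct_algebraicClasses_holds` on the smooth
projective sixfolds `A ⊗ (B ⊗ C)`.  The type is literally the route decl
`Summit.HodgeConjecture.HodgeConjecture.Theses.NikulinTwinTransport.TwinAnchorGlue`.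
[cite: Varesco2023, §2] [cite: Buskin2019, Lemma 6.3] [cite: VoisinHodgeII2003, §9.2.4 Prop. 9.20] -/
theorem nikulinTwinTransport_twinAnchorGlue_proof :
    Summit.HodgeConjecture.HodgeConjecture.Theses.NikulinTwinTransport.TwinAnchorGlue :=
  twinAnchorGlue_of_cup fun _ _ _ hA hB hC _ ha _ hb ↦
    Voisin2003_cupProduct_algebraicClasses_holds
      (IsSmoothProjective.tensor_holds hA (IsSmoothProjective.tensor_holds hB hC)) ha hb

end Summit.HodgeConjecture.HodgeConjecture.Theorems

end
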